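import Summits.QuantumFields.QCD.Theorems.PauliWegnerSeaChiralGluonicCompletionDefs
import Literature.MathematicalPhysics.QuantumFieldTheory.QCDFlavourSymmetry
import Summits.QuantumFields.QCD.Theorems.PauliWegnerSeaChiralGluonicCompletionStubChargedGapTwoDegenerate
import Literature.MathematicalPhysics.QuantumFieldTheory.QCDSiteReflectionPositivityProofs

/-!
# Crux `ChiralGluonicCompletion` (stmt-QuantumFields-17498), line `Sketch` — sub-goal of stub C1:
# at `N_f = 2` on the mass-degenerate line the full lattice gap REDUCES to the flavour-neutral sector

`stub_latticeGap_two_degenerate_of_neutral`: `HasNeutralLatticeMassGap Δ → HasLatticeMassGap (min Δ Δ_charged)` for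
`reg.scheme (t,t) 0 0` under `Hyp 2 reg`, `Δ_charged` the PQFD rate of the landed charged slice
`stub_chargedGap_two_degenerate`, via the scheme- and `N_f`-independent reduction
`hasLatticeMassGap_of_neutral_of_charged`: weight decomposition of the boxed quark Grassmann algebra under the vector
flavour torus into finitely many charge projections commuting with the gauge action (`exists_flavourWeightDecomposition`),
component observables (`exists_component`), bi-additivity of the connected correlation (`qcdLatticeConnectedCorr_sum_sum`,
integrable Berezin integrands by coefficient regularity), the flavour selection rule for the mixed terms, and a finite
sum of constants.  Everything here is proved.
-/

noncomputable section

namespace Summit.QuantumFields.QCD.Theorems.StronglyChiralSubsequence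

open MeasureTheory Filter Topology
open Literature.MathematicalPhysics.QuantumFieldTheory Literature.MathematicalPhysics.QuantumLattice
  Literature.Probability.LatticeModels

section Reduction

open QCDLatticeObservable GrassmannAlgebra
variable {Nf R : ℕ}

/-- **Flavour multi-charge of a monomial.**  There is an integer multi-charge `ch_s ∈ ℤ^{N_f}` of every monomial
index `s` (number of `ψ_f` minus number of `ψ̄_f` in `θ_s`) realising its torus weight:
`∏_{a ∈ s} flavourWeight t a = ∏_f t_f ^ {ch_s(f)}` for `t ∈ (ℂˣ)^{N_f}`. [folklore] -/
theorem exists_charge (Nf R : ℕ) :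
    ∃ ch : Finset (BoxFermiIdx Nf R ⊕ₗ BoxFermiIdx Nf R) → Fin Nf → ℤ, ∀ t : Fin Nf → ℂ, (∀ f, t f ≠ 0) →
      ∀ s, ∏ a ∈ s, flavourWeight t a = ∏ f, t f ^ ch s f := by
  -- the elementary charges of the generators: `−1_f` on `ψ̄_f`, `+1_f` on `ψ_f`
  let e : (BoxFermiIdx Nf R ⊕ₗ BoxFermiIdx Nf R) → Fin Nf → ℤ := fun w f =>
    Sum.elim (fun i => if (boxQuarkEquiv.symm i).1 = f then (-1 : ℤ) else 0)
      (fun i => if (boxQuarkEquiv.symm i).1 = f then (1 : ℤ) else 0) (ofLex w)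
  have he : ∀ t : Fin Nf → ℂ, (∀ f, t f ≠ 0) → ∀ w, flavourWeight (R := R) t w = ∏ f, t f ^ e w f := by
    intro t ht w
    induction w using lex_sum_ind <;> rename_i i <;> simp only [flavourWeight_inl, flavourWeight_inr] <;>
      rw [Finset.prod_eq_single (boxQuarkEquiv.symm i).1] <;>
      first
        | exact fun h => absurd (Finset.mem_univ _) h
        | exact fun f _ hf => by simp [e, Ne.symm hf]
        | simp [e]
  have hz : ∀ (s : Finset (BoxFermiIdx Nf R ⊕ₗ BoxFermiIdx Nf R)) (n : _ → ℤ) {c : ℂ}, c ≠ 0 →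
      ∏ a ∈ s, c ^ n a = c ^ ∑ a ∈ s, n a := fun s n c hc => by
    induction s using Finset.cons_induction with
    | empty => simp
    | cons a s ha ih => rw [Finset.prod_cons, Finset.sum_cons, zpow_add₀ hc, ih]
  refine ⟨fun s f => ∑ a ∈ s, e a f, fun t ht s => ?_⟩
  simp_rw [he t ht]
  rw [Finset.prod_comm]
  exact Finset.prod_congr rfl fun f _ => hz s (fun a => e a f) (ht f)

/-- **The torus separates multi-charges** (take `t_{f₀} = 2` at a flavour `f₀` where they differ). [folklore] -/
theorem exists_torus_separating {a b : Fin Nf → ℤ} (h : a ≠ b) :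
    ∃ t : Fin Nf → ℂ, (∀ f, t f ≠ 0) ∧ ∏ f, t f ^ a f ≠ ∏ f, t f ^ b f := by
  obtain ⟨f₀, hf₀⟩ := Function.ne_iff.1 h
  refine ⟨fun f => if f = f₀ then 2 else 1, fun f => by dsimp only; split_ifs <;> norm_num, ?_⟩
  · have key : ∀ c : Fin Nf → ℤ, ∏ f, (if f = f₀ then (2 : ℂ) else 1) ^ c f = 2 ^ c f₀ := fun c => by
      rw [Finset.prod_eq_single f₀ (fun f _ hf => by rw [if_neg hf, one_zpow])
        fun h => absurd (Finset.mem_univ _) h, if_pos rfl]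
    rw [key, key]
    intro h2
    have h3 := congrArg (‖·‖) h2
    simp only [norm_zpow, Complex.norm_ofNat] at h3
    exact hf₀ (zpow_right_injective₀ (by norm_num) (by norm_num) h3)

/-- The monomial coefficients of a flavour-rescaled element (the torus is diagonal on monomials). [folklore] -/
theorem coord_flavourScale (t : Fin Nf → ℂ) (y : BoxFermiAlg Nf R) (s : Finset (BoxFermiIdx Nf R ⊕ₗ BoxFermiIdx Nf R)) :
    (grassmannBasis ℂ _).coord s (flavourScale t y) = (∏ a ∈ s, flavourWeight t a) * (grassmannBasis ℂ _).coord s y := by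
  conv_lhs => rw [← (grassmannBasis ℂ _).sum_repr y]
  simp only [map_sum, map_smul, flavourScale_eq, exteriorMap_diag_grassmannBasis, smul_eq_mul,
    Module.Basis.coord_apply, Module.Basis.repr_self]
  rw [Finset.sum_eq_single s (fun u _ hus => by simp [Finsupp.single_eq_of_ne' hus])
    fun h => absurd (Finset.mem_univ s) h]
  simp [mul_comm]

/-- **The vector flavour torus commutes with every lattice gauge transformation** of the boxed quark Grassmann
algebra (colour mixing at fixed flavour/site/spin vs. a weight depending on flavour and `ψ̄`/`ψ` only). [folklore] -/
theorem flavourScale_fermiGaugeAct (t : Fin Nf → ℂ) (g : Literature.Probability.LatticeModels.Site 4 → SU3)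
    (x : BoxFermiAlg Nf R) : flavourScale t (fermiGaugeAct g x) = fermiGaugeAct g (flavourScale t x) := by
  have key : (LinearMap.pi fun w => flavourWeight t w •
        (LinearMap.proj w : (BoxFermiIdx Nf R ⊕ₗ BoxFermiIdx Nf R → ℂ) →ₗ[ℂ] ℂ)) ∘ₗ fermiGaugeLin g =
      fermiGaugeLin (Nf := Nf) (R := R) g ∘ₗ (LinearMap.pi fun w => flavourWeight t w •
        (LinearMap.proj w : (BoxFermiIdx Nf R ⊕ₗ BoxFermiIdx Nf R → ℂ) →ₗ[ℂ] ℂ)) := by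
    refine LinearMap.ext fun c => funext fun w => ?_
    obtain ⟨x, rfl⟩ : ∃ x, toLex x = w := ⟨ofLex w, rfl⟩
    rcases x with i | i <;>
      simp only [LinearMap.comp_apply, fermiGaugeLin, LinearMap.pi_apply, ofLex_toLex, LinearMap.coe_sum,
        Finset.sum_apply, LinearMap.smul_apply, LinearMap.proj_apply, Equiv.symm_apply_apply, smul_eq_mul,
        Finset.mul_sum, flavourWeight_inl, flavourWeight_inr] <;>
      exact Finset.sum_congr rfl fun a _ => by ring
  rw [fermiGaugeAct, flavourScale_eq, ← AlgHom.comp_apply, ExteriorAlgebra.map_comp_map, key,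
    ← ExteriorAlgebra.map_comp_map, AlgHom.comp_apply]

/-- **Off-charge coefficients of a weight vector vanish**: if `t · y = t^q y` for all `t ∈ (ℂˣ)^{N_f}`, the
coefficient of `y` on every monomial of multi-charge `≠ q` is zero (separate the two characters). [folklore] -/
theorem coord_eq_zero_of_weight {ch : Finset (BoxFermiIdx Nf R ⊕ₗ BoxFermiIdx Nf R) → Fin Nf → ℤ}
    (hch : ∀ t : Fin Nf → ℂ, (∀ f, t f ≠ 0) → ∀ s, ∏ a ∈ s, flavourWeight t a = ∏ f, t f ^ ch s f)
    {q : Fin Nf → ℤ} {y : BoxFermiAlg Nf R}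
    (hy : ∀ t : Fin Nf → ℂ, (∀ f, t f ≠ 0) → flavourScale t y = (∏ f, t f ^ q f) • y)
    {s : Finset (BoxFermiIdx Nf R ⊕ₗ BoxFermiIdx Nf R)} (hs : ch s ≠ q) : (grassmannBasis ℂ _).coord s y = 0 := by
  obtain ⟨t, ht, hne⟩ := exists_torus_separating hs
  have h1 := congrArg ((grassmannBasis ℂ _).coord s) (hy t ht)
  rw [coord_flavourScale, hch t ht, map_smul, smul_eq_mul] at h1
  have h2 : (∏ f, t f ^ ch s f - ∏ f, t f ^ q f) * (grassmannBasis ℂ _).coord s y = 0 := by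
    rw [sub_mul, h1, sub_self]
  exact (mul_eq_zero.1 h2).resolve_left (sub_ne_zero.2 hne)

/-- **The charge-`q` truncation of a weight-`q'` vector** is the vector itself if `q' = q` and zero otherwise. [folklore] -/
theorem sum_filter_coord_smul_of_weight {ch : Finset (BoxFermiIdx Nf R ⊕ₗ BoxFermiIdx Nf R) → Fin Nf → ℤ}
    (hch : ∀ t : Fin Nf → ℂ, (∀ f, t f ≠ 0) → ∀ s, ∏ a ∈ s, flavourWeight t a = ∏ f, t f ^ ch s f)
    {q' : Fin Nf → ℤ} {y : BoxFermiAlg Nf R}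
    (hy : ∀ t : Fin Nf → ℂ, (∀ f, t f ≠ 0) → flavourScale t y = (∏ f, t f ^ q' f) • y) (q : Fin Nf → ℤ) :
    ∑ s ∈ Finset.univ.filter (fun s => ch s = q), (grassmannBasis ℂ _).coord s y • grassmannBasis ℂ _ s =
      if q' = q then y else 0 := by
  split_ifs with hq
  · subst hq
    rw [Finset.sum_filter_of_ne fun s _ hs => ?_]
    · exact (grassmannBasis ℂ _).sum_repr y
    · by_contra h
      exact hs (by rw [coord_eq_zero_of_weight hch hy h, zero_smul])
  · refine Finset.sum_eq_zero fun s hs => ?_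
    rw [coord_eq_zero_of_weight hch hy fun h : ch s = q' => hq (h.symm.trans (Finset.mem_filter.1 hs).2), zero_smul]

/-- **Weight decomposition of the boxed quark Grassmann algebra under the vector flavour torus**: finitely many
multi-charges `Q` and linear projections `P_q` (truncation of the monomial expansion to charge `q`) with
`Σ_{q ∈ Q} P_q = id`, `t · P_q x = (∏_f t_f^{q_f}) P_q x`, each commuting with the gauge transformations. [folklore] -/
theorem exists_flavourWeightDecomposition (Nf R : ℕ) :
    ∃ (Q : Finset (Fin Nf → ℤ)) (P : (Fin Nf → ℤ) → BoxFermiAlg Nf R →ₗ[ℂ] BoxFermiAlg Nf R),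
      (∀ x, ∑ q ∈ Q, P q x = x) ∧
      (∀ q (t : Fin Nf → ℂ), (∀ f, t f ≠ 0) → ∀ x, flavourScale t (P q x) = (∏ f, t f ^ q f) • P q x) ∧
      (∀ q (g : Literature.Probability.LatticeModels.Site 4 → SU3) x, P q (fermiGaugeAct g x) = fermiGaugeAct g (P q x)) := by
  obtain ⟨ch, hch⟩ := exists_charge Nf R
  let b := grassmannBasis ℂ (BoxFermiIdx Nf R ⊕ₗ BoxFermiIdx Nf R)
  let P : (Fin Nf → ℤ) → BoxFermiAlg Nf R →ₗ[ℂ] BoxFermiAlg Nf R := fun q =>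
    ∑ s ∈ Finset.univ.filter (fun s => ch s = q), (b.coord s).smulRight (b s)
  have hP : ∀ q x, P q x = ∑ s ∈ Finset.univ.filter (fun s => ch s = q), b.coord s x • b s := fun q x => by
    simp only [P, LinearMap.coe_sum, Finset.sum_apply, LinearMap.smulRight_apply]
  have hbw : ∀ u (t : Fin Nf → ℂ), (∀ f, t f ≠ 0) → flavourScale t (b u) = (∏ f, t f ^ ch u f) • b u :=
    fun u t ht => by rw [flavourScale_eq, exteriorMap_diag_grassmannBasis, hch t ht]
  refine ⟨Finset.univ.image ch, P, fun x => ?_, fun q t ht x => ?_, fun q g x => ?_⟩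
  · simp only [hP]
    rw [Finset.sum_fiberwise_of_maps_to (fun s _ => Finset.mem_image_of_mem ch (Finset.mem_univ s))]
    exact b.sum_repr x
  · simp only [hP, map_sum, map_smul, Finset.smul_sum]
    refine Finset.sum_congr rfl fun s hs => ?_
    rw [hbw s t ht, (Finset.mem_filter.1 hs).2, smul_comm]
  · suffices h : (P q).comp (fermiGaugeAct g).toLinearMap = (fermiGaugeAct g).toLinearMap.comp (P q) from
      LinearMap.congr_fun h x
    refine b.ext fun u => ?_
    simp only [LinearMap.comp_apply, AlgHom.toLinearMap_apply, hP]
    have hw2 : ∀ t : Fin Nf → ℂ, (∀ f, t f ≠ 0) →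
        flavourScale t (fermiGaugeAct g (b u)) = (∏ f, t f ^ ch u f) • fermiGaugeAct g (b u) := fun t ht => by
      rw [flavourScale_fermiGaugeAct, hbw u t ht, map_smul]
    rw [sum_filter_coord_smul_of_weight hch hw2 q, sum_filter_coord_smul_of_weight hch (hbw u) q]
    split_ifs
    exacts [rfl, (map_zero _).symm]

/-- A placed observable `U ↦ A.onTorus S v U` is coefficient-regular (bounded measurable coefficients of `A.F`, a
measurable placement of the links, a fixed algebra map of the quark variables). [folklore] -/
theorem coeffRegular_onTorus {S : ℕ} [NeZero S] (A : QCDLatticeObservable Nf R)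
    (v : Literature.Probability.LatticeModels.Site 4) : CoeffRegular (fun U : GaugeConfig 4 S SU3 => A.onTorus S v U) := by
  unfold QCDLatticeObservable.onTorus
  exact ((coeffRegular_boxObs A).comp ((Literature.MathematicalPhysics.QuantumLattice.configShift _).measurable.comp
    (measurable_torusLift S))).algHom _

/-- **Additivity of the lattice QCD functional over finite sums of coefficient-regular observables**: the Berezin
integrands `U ↦ ∫dψ̄dψ X_k(U) e^{−ψ̄D(U)ψ}` are bounded and measurable (entries of `D(U)` continuous), hence integrable
against the Wilson probability measure, and the Bochner integral commutes with the finite sum. [folklore] -/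
theorem qcdTorusExpect_finset_sum {S : ℕ} [NeZero S] (β : ℝ) (mq : Fin Nf → ℝ) {K : Type*} (s : Finset K)
    (X : K → GaugeConfig 4 S SU3 → FermiAlg Nf S) (hX : ∀ k ∈ s, CoeffRegular (X k)) :
    qcdTorusExpect β S mq (fun U => ∑ k ∈ s, X k U) = ∑ k ∈ s, qcdTorusExpect β S mq (X k) := by
  have hB : CoeffRegular (fun U : GaugeConfig 4 S SU3 => fermiBoltzmann U mq) := by
    unfold fermiBoltzmann
    exact (coeffRegular_quadratic fun p q =>
      (continuous_diracMatrix mq).neg.matrix_elem p q).grassmannExp fun U => coord_empty_quadratic _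
  unfold qcdTorusExpect
  rw [← Finset.sum_div]
  congr 1
  have h : ∀ U : GaugeConfig 4 S SU3, fermiIntegral ((∑ k ∈ s, X k U) * fermiBoltzmann U mq) =
      ∑ k ∈ s, fermiIntegral (X k U * fermiBoltzmann U mq) := fun U => by rw [Finset.sum_mul, map_sum]
  simp_rw [h]
  refine integral_finsetSum s fun k hk => ?_
  obtain ⟨C, hC⟩ := ((hX k hk).mul hB).exists_norm_apply_le fermiIntegral
  exact Integrable.of_bound (((hX k hk).mul hB).measurable_apply fermiIntegral).aestronglyMeasurable C
    (Eventually.of_forall hC)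

/-- **Component observables**: the image of a gauge-invariant local observable under a fixed linear map of the boxed
Grassmann algebra commuting with the gauge action is again one (same links; coefficient regularity of `A.F`). [folklore] -/
theorem exists_component (A : QCDLatticeObservable Nf R) (P : BoxFermiAlg Nf R →ₗ[ℂ] BoxFermiAlg Nf R)
    (hP : ∀ (g : Literature.Probability.LatticeModels.Site 4 → SU3) x, P (fermiGaugeAct g x) = fermiGaugeAct g (P x)) :
    ∃ A' : QCDLatticeObservable Nf R, ∀ U, A'.F U = P (A.F U) :=
  ⟨{ F := fun U => P (A.F U)
     supp := A.supp
     isCylinder := fun _ _ h => congrArg P (A.isCylinder h)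
     gaugeInvariant := fun g U => by
       show fermiGaugeAct g (P (A.F (gaugeTransformZd g U))) = P (A.F U)
       rw [← hP, A.gaugeInvariant]
     bounded := fun y => (coeffRegular_boxObs A).exists_norm_apply_le
       ((berezin ℂ (BoxFermiIdx Nf R ⊕ₗ BoxFermiIdx Nf R)).comp ((LinearMap.mulRight ℂ y).comp P))
     measurable := fun y => (coeffRegular_boxObs A).measurable_apply
       ((berezin ℂ (BoxFermiIdx Nf R ⊕ₗ BoxFermiIdx Nf R)).comp ((LinearMap.mulRight ℂ y).comp P)) }, fun _ => rfl⟩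

/-- A finite decomposition of `A.F` induces the same decomposition of every torus placement. [folklore] -/
theorem onTorus_eq_sum {S : ℕ} [NeZero S] {K : Type*} (s : Finset K) (A : QCDLatticeObservable Nf R)
    (Ac : K → QCDLatticeObservable Nf R) (hA : ∀ U, ∑ k ∈ s, (Ac k).F U = A.F U)
    (v : Literature.Probability.LatticeModels.Site 4) (U : GaugeConfig 4 S SU3) :
    A.onTorus S v U = ∑ k ∈ s, (Ac k).onTorus S v U := by
  simp only [QCDLatticeObservable.onTorus, ← map_sum, hA]

/-- **Bi-additivity of the connected correlation over finite decompositions of the two observables.** [folklore] -/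
theorem qcdLatticeConnectedCorr_sum_sum {R' S : ℕ} [NeZero S] (β : ℝ) (mq : Fin Nf → ℝ)
    (A : QCDLatticeObservable Nf R) (B : QCDLatticeObservable Nf R') (n : ℕ) {K K' : Type*} (sA : Finset K)
    (sB : Finset K') (Ac : K → QCDLatticeObservable Nf R) (Bc : K' → QCDLatticeObservable Nf R')
    (hA : ∀ U, ∑ k ∈ sA, (Ac k).F U = A.F U) (hB : ∀ U, ∑ k ∈ sB, (Bc k).F U = B.F U) :
    qcdLatticeConnectedCorr β S mq A B n = ∑ k ∈ sA, ∑ k' ∈ sB, qcdLatticeConnectedCorr β S mq (Ac k) (Bc k') n := by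
  have hr : ∀ (k k') (v v' : Literature.Probability.LatticeModels.Site 4),
      CoeffRegular fun U : GaugeConfig 4 S SU3 => (Ac k).onTorus S v U * (Bc k').onTorus S v' U :=
    fun k k' v v' => (coeffRegular_onTorus _ _).mul (coeffRegular_onTorus _ _)
  have e1 : qcdTorusExpect β S mq (fun U => A.onTorus S 0 U * B.onTorus S (Pi.single 0 (n : ℤ)) U) =
      ∑ k ∈ sA, ∑ k' ∈ sB, qcdTorusExpect β S mq
        (fun U => (Ac k).onTorus S 0 U * (Bc k').onTorus S (Pi.single 0 (n : ℤ)) U) := by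
    have h : (fun U => A.onTorus S 0 U * B.onTorus S (Pi.single 0 (n : ℤ)) U) = fun U =>
        ∑ k ∈ sA, ∑ k' ∈ sB, (Ac k).onTorus S 0 U * (Bc k').onTorus S (Pi.single 0 (n : ℤ)) U := by
      funext U
      rw [onTorus_eq_sum sA A Ac hA, onTorus_eq_sum sB B Bc hB, Finset.sum_mul_sum]
    rw [h, qcdTorusExpect_finset_sum β mq sA _ fun k _ => CoeffRegular.sum sB fun k' _ => hr k k' _ _]
    exact Finset.sum_congr rfl fun k _ => qcdTorusExpect_finset_sum β mq sB _ fun k' _ => hr k k' _ _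
  have e2 : qcdTorusExpect β S mq (A.onTorus S 0) = ∑ k ∈ sA, qcdTorusExpect β S mq ((Ac k).onTorus S 0) := by
    have h : A.onTorus S 0 = fun U => ∑ k ∈ sA, (Ac k).onTorus S 0 U := funext fun U => onTorus_eq_sum sA A Ac hA 0 U
    rw [h, qcdTorusExpect_finset_sum β mq sA _ fun k _ => coeffRegular_onTorus _ _]
  have e3 : qcdTorusExpect β S mq (B.onTorus S (Pi.single 0 (n : ℤ))) =
      ∑ k' ∈ sB, qcdTorusExpect β S mq ((Bc k').onTorus S (Pi.single 0 (n : ℤ))) := by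
    have h : B.onTorus S (Pi.single 0 (n : ℤ)) = fun U => ∑ k' ∈ sB, (Bc k').onTorus S (Pi.single 0 (n : ℤ)) U :=
      funext fun U => onTorus_eq_sum sB B Bc hB _ U
    rw [h, qcdTorusExpect_finset_sum β mq sB _ fun k _ => coeffRegular_onTorus _ _]
  unfold qcdLatticeConnectedCorr
  rw [e1, e2, e3, Finset.sum_mul_sum, ← Finset.sum_sub_distrib]
  refine Finset.sum_congr rfl fun k _ => ?_
  rw [← Finset.sum_sub_distrib]

/-- The verbatim flavour phase of `PhaseQuenchedFlavourDecay` (`ψ̄_{f₀} ↦ e^{−iθ}ψ̄_{f₀}`, `ψ_{f₀} ↦ e^{iθ}ψ_{f₀}`) is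
`flavourScale t` at `t_{f₀} = e^{iθ}`, `t_f = 1` otherwise. [folklore] -/
theorem exteriorMap_phase_eq_flavourScale (f₀ : Fin Nf) (θ : ℝ) :
    ExteriorAlgebra.map (LinearMap.pi fun w : BoxFermiIdx Nf R ⊕ₗ BoxFermiIdx Nf R => (Sum.elim
        (fun i => if (boxQuarkEquiv.symm i).1 = f₀ then Complex.exp (-((θ : ℂ) * Complex.I)) else 1)
        (fun i => if (boxQuarkEquiv.symm i).1 = f₀ then Complex.exp ((θ : ℂ) * Complex.I) else 1)
        (ofLex w)) • LinearMap.proj w) =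
      flavourScale (R := R) (fun f : Fin Nf => if f = f₀ then Complex.exp ((θ : ℂ) * Complex.I) else 1) := by
  rw [flavourScale_eq]
  congr 1
  refine LinearMap.ext fun x => funext fun w => ?_
  simp only [LinearMap.pi_apply, LinearMap.smul_apply, smul_eq_mul]
  congr 1
  induction w using lex_sum_ind with
  | hl a =>
    simp only [flavourWeight_inl, ofLex_toLex, Sum.elim_inl]
    split_ifs
    · exact Complex.exp_neg _
    · exact inv_one.symm
  | hr b => simp only [flavourWeight_inr, ofLex_toLex, Sum.elim_inr]

/-- The phase `t_{f₀} = e^{iθ}`, `t_f = 1` otherwise, lies in the torus `(ℂˣ)^{N_f}`. [folklore] -/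
theorem phase_ne_zero (f₀ : Fin Nf) (θ : ℝ) (f : Fin Nf) :
    (fun f : Fin Nf => if f = f₀ then Complex.exp ((θ : ℂ) * Complex.I) else 1) f ≠ 0 := by
  dsimp only
  split_ifs
  exacts [Complex.exp_ne_zero _, one_ne_zero]

/-- The character of the phase `t_{f₀} = e^{iθ}` on the multi-charge `q` is `e^{i q_{f₀} θ}`. [folklore] -/
theorem prod_phase_zpow (f₀ : Fin Nf) (θ : ℝ) (q : Fin Nf → ℤ) :
    ∏ f, (fun f : Fin Nf => if f = f₀ then Complex.exp ((θ : ℂ) * Complex.I) else 1) f ^ q f =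
      Complex.exp ((((q f₀ : ℝ) * θ : ℝ) : ℂ) * Complex.I) := by
  rw [Finset.prod_eq_single f₀ (fun f _ hf => by simp only [if_neg hf, one_zpow]) fun h => absurd (Finset.mem_univ _) h]
  simp only [if_true, ← Complex.exp_int_mul]
  exact congrArg Complex.exp (by push_cast; ring)

/-- **Selection rule for an invariant × charged product**: `⟨X · B(v)⟩ = 0` on every torus for `X` fixed by the
vector flavour torus (e.g. `1`, or a placed flavour-neutral observable) and `B` of non-zero multi-charge `q`
(`q_{f₀} ≠ 0`; the phase `θ = π/q_{f₀}` of flavour `f₀` acts on the product by `−1`). [folklore] -/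
theorem qcdTorusExpect_mul_charged_eq_zero {R' S : ℕ} [NeZero S] (X : GaugeConfig 4 S SU3 → FermiAlg Nf S)
    (hX : ∀ t : Fin Nf → ℂ, (∀ f, t f ≠ 0) → ∀ U, fermiFlavourScale t (X U) = X U) (B : QCDLatticeObservable Nf R')
    {q : Fin Nf → ℤ} (hq : q ≠ 0)
    (hB : ∀ t : Fin Nf → ℂ, (∀ f, t f ≠ 0) → ∀ U, flavourScale t (B.F U) = (∏ f, t f ^ q f) • B.F U)
    (β : ℝ) (mq : Fin Nf → ℝ) (v : Literature.Probability.LatticeModels.Site 4) :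
    qcdTorusExpect β S mq (fun U => X U * B.onTorus S v U) = 0 := by
  obtain ⟨f₀, hf₀⟩ := Function.ne_iff.1 hq
  obtain ⟨θ, hθ⟩ : ∃ θ : ℝ, (q f₀ : ℝ) * θ = Real.pi := ⟨Real.pi / q f₀, mul_div_cancel₀ _ (Int.cast_ne_zero.2 hf₀)⟩
  have hc : Complex.exp ((((q f₀ : ℝ) * θ : ℝ) : ℂ) * Complex.I) ≠ 1 := by
    rw [hθ, Complex.exp_pi_mul_I]; norm_num
  refine qcdTorusExpect_eq_zero_of_fermiFlavourScale (phase_ne_zero f₀ θ) hc β mq _ fun U => ?_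
  rw [map_mul, hX _ (phase_ne_zero f₀ θ), fermiFlavourScale_onTorus, hB _ (phase_ne_zero f₀ θ), prod_phase_zpow,
    map_smul, mul_smul_comm]
  rfl

/-- A uniform correlation bound at rate `Δ` is a bound at every rate `Δ' ≤ Δ` (with a non-negative constant). [folklore] -/
theorem eventually_corrBound_mono (sch : QCDScheme Nf) {Δ Δ' C : ℝ} (hΔ : Δ' ≤ Δ) {R' : ℕ}
    {A : QCDLatticeObservable Nf R} {B : QCDLatticeObservable Nf R'}
    (h : ∀ᶠ k in atTop, ∀ S : ℕ, sch.L k ≤ S → ∀ n : ℕ, n ≤ S →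
      ‖qcdLatticeConnectedCorr (sch.β k) (2 * S + 1) (fun fl => sch.mq fl k) A B n‖ ≤ C * Real.exp (-(Δ * (sch.a k * n)))) :
    ∃ C' : ℝ, ∀ᶠ k in atTop, ∀ S : ℕ, sch.L k ≤ S → ∀ n : ℕ, n ≤ S →
      ‖qcdLatticeConnectedCorr (sch.β k) (2 * S + 1) (fun fl => sch.mq fl k) A B n‖ ≤
        C' * Real.exp (-(Δ' * (sch.a k * n))) := by
  refine ⟨max C 0, h.mono fun k hk S hS n hn => (hk S hS n hn).trans ?_⟩
  have hx : 0 ≤ sch.a k * n := mul_nonneg (sch.a_pos k).le n.cast_nonneg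
  calc C * Real.exp (-(Δ * (sch.a k * n)))
      ≤ max C 0 * Real.exp (-(Δ * (sch.a k * n))) := mul_le_mul_of_nonneg_right (le_max_left _ _) (Real.exp_nonneg _)
    _ ≤ max C 0 * Real.exp (-(Δ' * (sch.a k * n))) :=
        mul_le_mul_of_nonneg_left (Real.exp_le_exp.2 (by nlinarith)) (le_max_right _ _)

/-- **Neutral gap + charged gap ⇒ full lattice gap** (any `N_f`, any scheme): if the flavour-neutral pairs have the
uniform lattice gap `Δn` and every pair whose first observable has a definite NON-ZERO flavour multi-charge obeys the
uniform bound at rate `Δc`, then all pairs have the uniform gap `min Δn Δc` — decompose both observables into their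
finitely many charge components, expand the connected correlation bi-additively, kill neutral × charged terms by the
selection rule, bound the others by the two hypotheses, and sum the finitely many constants. [folklore] -/
theorem hasLatticeMassGap_of_neutral_of_charged (sch : QCDScheme Nf) {Δn Δc : ℝ} (hN : sch.HasNeutralLatticeMassGap Δn)
    (hC : ∀ (R R' : ℕ) (A : QCDLatticeObservable Nf R) (B : QCDLatticeObservable Nf R'),
      (∃ q : Fin Nf → ℤ, q ≠ 0 ∧ ∀ t : Fin Nf → ℂ, (∀ f, t f ≠ 0) → ∀ U,
          flavourScale t (A.F U) = (∏ f, t f ^ q f) • A.F U) →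
        ∃ C : ℝ, ∀ᶠ k in atTop, ∀ S : ℕ, sch.L k ≤ S → ∀ n : ℕ, n ≤ S →
          ‖qcdLatticeConnectedCorr (sch.β k) (2 * S + 1) (fun fl => sch.mq fl k) A B n‖ ≤
            C * Real.exp (-(Δc * (sch.a k * n)))) :
    sch.HasLatticeMassGap (min Δn Δc) := by
  intro R R' A B
  obtain ⟨QA, PA, hPA1, hPA2, hPA3⟩ := exists_flavourWeightDecomposition Nf R
  obtain ⟨QB, PB, hPB1, hPB2, hPB3⟩ := exists_flavourWeightDecomposition Nf R'
  choose Ac hAc using fun q => exists_component A (PA q) (hPA3 q)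
  choose Bc hBc using fun q => exists_component B (PB q) (hPB3 q)
  have hAw : ∀ q (t : Fin Nf → ℂ), (∀ f, t f ≠ 0) → ∀ U, flavourScale t ((Ac q).F U) = (∏ f, t f ^ q f) • (Ac q).F U :=
    fun q t ht U => by rw [hAc]; exact hPA2 q t ht _
  have hBw : ∀ q (t : Fin Nf → ℂ), (∀ f, t f ≠ 0) → ∀ U, flavourScale t ((Bc q).F U) = (∏ f, t f ^ q f) • (Bc q).F U :=
    fun q t ht U => by rw [hBc]; exact hPB2 q t ht _
  have hA0 : (Ac 0).IsFlavourNeutral := fun t ht U => by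
    rw [hAw 0 t ht U]; simp only [Pi.zero_apply, zpow_zero, Finset.prod_const_one, one_smul]
  have hB0 : (Bc 0).IsFlavourNeutral := fun t ht U => by
    rw [hBw 0 t ht U]; simp only [Pi.zero_apply, zpow_zero, Finset.prod_const_one, one_smul]
  -- every pair of components obeys the bound at the common rate
  have key : ∀ p : (Fin Nf → ℤ) × (Fin Nf → ℤ), ∃ C : ℝ, ∀ᶠ k in atTop, ∀ S : ℕ, sch.L k ≤ S → ∀ n : ℕ, n ≤ S →
      ‖qcdLatticeConnectedCorr (sch.β k) (2 * S + 1) (fun fl => sch.mq fl k) (Ac p.1) (Bc p.2) n‖ ≤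
        C * Real.exp (-(min Δn Δc * (sch.a k * n))) := by
    rintro ⟨qa, qb⟩
    dsimp only
    by_cases hqa : qa = 0
    · subst hqa
      by_cases hqb : qb = 0
      · subst hqb
        obtain ⟨C, hCk⟩ := hN R R' (Ac 0) (Bc 0) hA0 hB0
        exact eventually_corrBound_mono sch (min_le_left _ _) hCk
      · refine ⟨0, Eventually.of_forall fun k S _ n _ => ?_⟩
        have h1 := qcdTorusExpect_mul_charged_eq_zero (fun _ => 1) (fun s hs U => map_one _) (Bc qb) hqb (hBw qb)
          (sch.β k) (fun fl => sch.mq fl k) (Pi.single 0 (n : ℤ)) (S := 2 * S + 1)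
        simp only [one_mul] at h1
        rw [qcdLatticeConnectedCorr, qcdTorusExpect_mul_charged_eq_zero _
          (fun s hs U => hA0.fermiFlavourScale_onTorus hs 0 U) (Bc qb) hqb (hBw qb), h1, mul_zero, sub_zero, norm_zero,
          zero_mul]
    · obtain ⟨C, hCk⟩ := hC R R' (Ac qa) (Bc qb) ⟨qa, hqa, hAw qa⟩
      exact eventually_corrBound_mono sch (min_le_right _ _) hCk
  choose C hCk using key
  refine ⟨∑ p ∈ QA ×ˢ QB, C p, ?_⟩
  filter_upwards [(Filter.eventually_all_finset (QA ×ˢ QB)).2 fun p _ => hCk p] with k hk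
  intro S hS n hn
  rw [qcdLatticeConnectedCorr_sum_sum (sch.β k) (fun fl => sch.mq fl k) A B n QA QB Ac Bc
      (fun U => by simp only [hAc]; exact hPA1 _) (fun U => by simp only [hBc]; exact hPB1 _),
    ← Finset.sum_product', Finset.sum_mul]
  exact (norm_sum_le _ _).trans (Finset.sum_le_sum fun p hp => hk p hp S hS n hn)

end Reduction

/-- **C1 on the degenerate `N_f = 2` line is the NEUTRAL-sector gap.**  For a regularisation carrying the crux's package
and a degenerate positive tuple `(t,t)`: if the flavour-neutral pairs have a uniform lattice gap
(`QCDScheme.HasNeutralLatticeMassGap`), then ALL pairs do (`QCDScheme.HasLatticeMassGap`), at the smaller of that rate and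
the PQFD rate — every observable splits into finitely many flavour-charge components (weight spaces of the vector flavour
torus on the boxed Grassmann algebra), the connected correlation is additive in each slot, mixed-charge terms vanish by
the selection rule, charged components are handled by `stub_chargedGap_two_degenerate`, neutral ones by the hypothesis. -/
theorem stub_latticeGap_two_degenerate_of_neutral : ∀ reg : QCDRegularisation 2, Hyp 2 reg → ∀ t : ℝ, 0 < t →
    (∃ Δ > 0, (reg.scheme (fun _ => t) 0 0).HasNeutralLatticeMassGap Δ) →
      ∃ Δ > 0, (reg.scheme (fun _ => t) 0 0).HasLatticeMassGap Δ := by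
  rintro reg hH t ht ⟨Δn, hΔn, hN⟩
  obtain ⟨Δc, hΔc, hC⟩ := stub_chargedGap_two_degenerate reg hH t ht
  refine ⟨min Δn Δc, lt_min hΔn hΔc, hasLatticeMassGap_of_neutral_of_charged _ hN fun R R' A B hA => ?_⟩
  obtain ⟨q, hq, hAq⟩ := hA
  obtain ⟨f₀, hf₀⟩ := Function.ne_iff.1 hq
  -- a weight vector of multi-charge `q` carries the `U(1)_{f₀}` charge `q f₀ ≠ 0` in PQFD's verbatim form
  exact hC R R' A B ⟨f₀, q f₀, hf₀, fun θ U => by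
    rw [exteriorMap_phase_eq_flavourScale, hAq _ (phase_ne_zero f₀ θ) U, prod_phase_zpow]⟩

end Summit.QuantumFields.QCD.Theorems.StronglyChiralSubsequence

end
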